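import Summits.AtomisticToContinuum.Crystallization.Theorems.PalmUnimodularRigidityLayeredLawsSelectHcpRelaxedReference
import Summits.AtomisticToContinuum.Crystallization.Theorems.ThreeConeCertificateSlackRigidityUniqUniqueMax
import Summits.AtomisticToContinuum.Crystallization.Theorems.ThreeConeCertificateSlackRigidityUniqExclusion

/-!
# The global minimiser of the hcp energy function is unique
(registered sub-goal `tube_hcpE_unique_minimiser` of stub `stub_tubeZeroDefect`, line
`mtp-prestress-split-ergodic-frame`, crux `LayeredLawsSelectHcp`, stmt-AtomisticToContinuum-9226)

The total energy function `hcpE a h = ½ ∑_{v ≠ 0} V_LJ(√(a² Q v + k² h²))` of the Defs module has EXACTLY ONE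
global minimiser over the open quadrant `{a > 0, h > 0}`.  Proof.

* SHAPE DATA OF A MINIMISER (`hcpE_globalMin_shape`): write `h = a c`; by the landed series algebra
  (`hcpE_eq_hcpSumS`, `hcpPinC_dilation_value/eq`, `hcpE_ge_shape`) a global minimiser has the optimal dilation
  `a⁶ = S₆(c)/S₃(c)` and its layer ratio `c` is a GLOBAL MAXIMISER of the shape function `F = S₃²/S₆` on
  `(0, ∞)` (`S_n = hcpSumS n` of `…CoarseGrainsPinSums`, the certified lattice sums).
* LOCALISATION (`shape_globalMax_mem_box`): a global maximiser of `F` lies in the open box `(0.78, 0.85)`: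
  outside it the certified exclusion of this line (`stub_relaxedReferenceExclusion`) gives
  `F ≤ 14.457431022²/12.138038647`, which is STRICTLY below the certified reference value
  `14.450852575²/12.126150439 ≤ F(4083/5000)` of the landed unique-maximiser development
  (`EkelandSurgeryParityUniq.shapeL_le`).
* UNIQUENESS OF THE SHAPE: two maximisers of `F` on `[7/10, 9/10]` coincide — the landed certified
  strict monotonicity of the Fermat function `S₆D₃ − S₃D₆` (`EkelandSurgeryParityUniq.stub_hcpShapeUniqueMax`,
  crux `SlackRigidity`, same sums `hcpSumS`).
* ASSEMBLY (`tube_hcpE_unique_minimiser`): both `(a₀, h₀)` and `(a₁, h₁)` are global minimisers (the second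
  by the equality of values), so `h₀/a₀ = h₁/a₁ =: c`, `a₀⁶ = a₁⁶ = S₆(c)/S₃(c)`, hence `a₀ = a₁`, `h₀ = h₁`.

All `[folklore]`; no new definitions, no new numerics.
-/

noncomputable section

namespace Summit.AtomisticToContinuum.Crystallization.Theorems.PalmUnimodularRigidity.LayeredLawsSelectHcp

open MeasureTheory Set
open Literature.MathematicalPhysics.StatisticalMechanics Literature.Geometry.DiscreteGeometry
open Summit.AtomisticToContinuum.Crystallization.Theorems.ExcessDecayLiouvilleCoarseGrains
open Summit.AtomisticToContinuum.Crystallization.Theorems.EkelandSurgeryParityUniq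
  (stub_hcpShapeUniqueMax shapeL_le)

/-! ## Shape data of a global minimiser -/

/-- **Shape data of a global minimiser.**  If `hcpE a (a c) ≤ hcpE a' h'` for all `a', h' > 0`
(`a, c > 0`), then the dilation is optimal, `a⁶ = S₆(c)/S₃(c)`, and the layer ratio `c` is a global
maximiser of the shape function `S₃²/S₆` on `(0, ∞)` (comparison with the optimally dilated hcp of every
shape `c'`: `hcpE b (b c') = −S₃(c')²/(24 S₆(c'))` for `b⁶ = S₆(c')/S₃(c')`). [folklore] -/
theorem hcpE_globalMin_shape {a c : ℝ} (ha : 0 < a) (hc : 0 < c)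
    (hmin : ∀ a' h' : ℝ, 0 < a' → 0 < h' → hcpE a (a * c) ≤ hcpE a' h') :
    a ^ 6 = hcpSumS 6 c / hcpSumS 3 c ∧
      ∀ c' : ℝ, 0 < c' → hcpSumS 3 c' ^ 2 / hcpSumS 6 c' ≤ hcpSumS 3 c ^ 2 / hcpSumS 6 c := by
  have hS3 := hcpSumS_pos' (le_refl 3) hc
  have hS6 := hcpSumS_pos' (by norm_num : 3 ≤ 6) hc
  -- comparison with the optimally dilated hcp of shape `c'`
  have hI : ∀ c' : ℝ, 0 < c' → hcpE a (a * c) ≤ -(hcpSumS 3 c' ^ 2 / (24 * hcpSumS 6 c')) := by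
    intro c' hc'
    have h3 := hcpSumS_pos' (le_refl 3) hc'
    have h6 := hcpSumS_pos' (by norm_num : 3 ≤ 6) hc'
    have hq : 0 < hcpSumS 6 c' / hcpSumS 3 c' := div_pos h6 h3
    obtain ⟨b, hb0, hb6⟩ : ∃ b : ℝ, 0 < b ∧ b ^ 6 = hcpSumS 6 c' / hcpSumS 3 c' :=
      ⟨(hcpSumS 6 c' / hcpSumS 3 c') ^ ((6 : ℕ) : ℝ)⁻¹, Real.rpow_pos_of_pos hq _,
        Real.rpow_inv_natCast_pow hq.le (by norm_num)⟩
    have key := hmin b (b * c') hb0 (mul_pos hb0 hc')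
    rw [hcpE_eq_hcpSumS hb0.ne' hc'.ne', hcpPinC_dilation_value h3 h6 hb6] at key
    exact key
  refine ⟨?_, fun c' hc' => ?_⟩
  · have h := hI c hc
    rw [hcpE_eq_hcpSumS ha.ne' hc.ne'] at h
    exact hcpPinC_dilation_eq hS3 hS6 ha.ne' h
  · exact hcpPinC_shape_le hS6 (hcpSumS_pos' (by norm_num : 3 ≤ 6) hc')
      ((hcpE_ge_shape ha hc).trans (hI c' hc'))

/-! ## Localisation of the optimal shape -/

/-- **A global maximiser of the shape function lies in the open box `(0.78, 0.85)`**: outside the box the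
certified exclusion of this line bounds `S₃²/S₆` by `14.457431022²/12.138038647`, strictly below the
certified reference value `14.450852575²/12.126150439 ≤ (S₃²/S₆)(4083/5000)`. [folklore] -/
theorem shape_globalMax_mem_box {c : ℝ} (hc : 0 < c)
    (hmax : ∀ c' : ℝ, 0 < c' → hcpSumS 3 c' ^ 2 / hcpSumS 6 c' ≤ hcpSumS 3 c ^ 2 / hcpSumS 6 c) :
    39 / 50 < c ∧ c < 17 / 20 := by
  by_contra hcon
  have hout : c ≤ 39 / 50 ∨ 17 / 20 ≤ c := by
    rcases not_and_or.1 hcon with h | h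
    · exact Or.inl (not_lt.1 h)
    · exact Or.inr (not_lt.1 h)
  have hex := stub_relaxedReferenceExclusion c hc hout
  have h6 := hcpSumS_pos' (by norm_num : 3 ≤ 6) hc
  have hFc : hcpSumS 3 c ^ 2 / hcpSumS 6 c ≤ 14.457431022 ^ 2 / 12.138038647 := by
    rw [div_le_div_iff₀ h6 (by norm_num)]
    linarith
  have hLL : (14.457431022 : ℝ) ^ 2 / 12.138038647 < 14.450852575 ^ 2 / 12.126150439 := by norm_num
  have href := hmax ((4083 : ℝ) / 5000) (by norm_num)
  linarith [shapeL_le]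

/-! ## The statement -/

/-- **Registered sub-goal `tube_hcpE_unique_minimiser` of stub `stub_tubeZeroDefect` (line
`mtp-prestress-split-ergodic-frame`, crux `LayeredLawsSelectHcp`, stmt-AtomisticToContinuum-9226): THE GLOBAL
MINIMISER OF THE hcp ENERGY FUNCTION IS UNIQUE.**  If `(a₀, h₀)` minimises `hcpE` over the open quadrant and
`(a₁, h₁)` has the same energy, then `(a₁, h₁) = (a₀, h₀)`: both layer ratios `hᵢ/aᵢ` are global maximisers of
`S₃²/S₆`, hence lie in `(0.78, 0.85)` and coincide by the certified unique-maximiser theorem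
`stub_hcpShapeUniqueMax`; then `a₀⁶ = a₁⁶ = S₆/S₃` at the common ratio. [folklore] -/
theorem tube_hcpE_unique_minimiser : ∀ a₀ h₀ a₁ h₁ : ℝ, 0 < a₀ → 0 < h₀ → 0 < a₁ → 0 < h₁ → (∀ a h : ℝ, 0 < a → 0 < h → hcpE a₀ h₀ ≤ hcpE a h) → hcpE a₁ h₁ = hcpE a₀ h₀ → a₁ = a₀ ∧ h₁ = h₀ := by
  intro a₀ h₀ a₁ h₁ ha₀ hh₀ ha₁ hh₁ hmin heq
  obtain ⟨c₀, rfl⟩ : ∃ c, h₀ = a₀ * c := ⟨h₀ / a₀, by field_simp⟩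
  obtain ⟨c₁, rfl⟩ : ∃ c, h₁ = a₁ * c := ⟨h₁ / a₁, by field_simp⟩
  have hc₀ : 0 < c₀ := pos_of_mul_pos_right hh₀ ha₀.le
  have hc₁ : 0 < c₁ := pos_of_mul_pos_right hh₁ ha₁.le
  have hmin₁ : ∀ a h : ℝ, 0 < a → 0 < h → hcpE a₁ (a₁ * c₁) ≤ hcpE a h :=
    fun a h ha hh => heq.le.trans (hmin a h ha hh)
  obtain ⟨ha6₀, hF₀⟩ := hcpE_globalMin_shape ha₀ hc₀ hmin
  obtain ⟨ha6₁, hF₁⟩ := hcpE_globalMin_shape ha₁ hc₁ hmin₁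
  obtain ⟨l₀, r₀⟩ := shape_globalMax_mem_box hc₀ hF₀
  obtain ⟨l₁, r₁⟩ := shape_globalMax_mem_box hc₁ hF₁
  have hcc : c₀ = c₁ :=
    stub_hcpShapeUniqueMax c₀ c₁ (by linarith) (by linarith) (by linarith) (by linarith)
      (fun x hx1 _ => hF₀ x (by linarith)) (fun x hx1 _ => hF₁ x (by linarith))
  subst hcc
  have haa : a₁ = a₀ := by
    have h6 : a₁ ^ 6 = a₀ ^ 6 := by rw [ha6₀, ha6₁]
    exact (pow_left_inj₀ ha₁.le ha₀.le (by norm_num)).1 h6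
  subst haa
  exact ⟨rfl, rfl⟩

end Summit.AtomisticToContinuum.Crystallization.Theorems.PalmUnimodularRigidity.LayeredLawsSelectHcp

end
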